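import Literature.NumberTheory.EllipticCurves.PAdicLFunctionTameMultProofs
import Literature.NumberTheory.EllipticCurves.PAdicLFunctionTameMultLevelChangeProofs
import Literature.NumberTheory.EllipticCurves.PAdicLFunctionTameEulerFactorSeriesProofs
import HarnessLib

/-!
# Matsuno 2000, Lemma 3.3 for the ONE-TERM tame transform (`p ∣ N`, `ε(p) = 0`): raising the tame level at a good
# prime `ℓ` multiplies the depleted function by `h_ℓ = a_ℓ − (1+T)^{−c_ℓ} − (1+T)^{c_ℓ}`, and its iteration over the
# primes of a squarefree tame level (PROOFS ONLY: no `def`, no named fact)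

Companion of `PAdicLFunctionTameMult` (cell bsd-2adic, seat conv-1 GEN 13, road «hKan-mult»); the one-term twin of
`PAdicLFunctionTameEulerFactorProofs` / `PAdicLFunctionTameEulerFactorSeriesProofs` (Matsuno, J. Number Theory 84 (2000),
Lemma 3.3, pp. 87–88: `G_{p,mℓ}(E, φ, T) = h_ℓ(E, φ, T) G_{p,m}(E, φ, T)` with `ε(ℓ) = 1` at the GOOD prime `ℓ ∤ pmN`, trivial
tame character `φ = 𝟙_m`). The passage measure ↦ transform is the abstract translation lemma
`tendsto_riemannSum_translate` over `PAdicMeasureTransform`, fed with the one-term distribution relation / bound / level change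
(`PAdicLFunctionTameMultProofs`, `PAdicLFunctionTameMultLevelChangeProofs`):

* `padicLRiemannSumTameMult_mul_prime_eq` — level-`n` form: the Riemann sum of `L_p(f,α,𝟙_{mℓ})` is `a_ℓ ·` that of
  `L_p(f,α,𝟙_m)` minus the Riemann sums of the `𝟙_m`-weighted measure translated by `ℓ` and by `ℓ⁻¹`;
* `padicLCoeffTameMult_mul_prime`, `padicLFunctionTameMult_mul_prime` — Lemma 3.3 coefficientwise and as ONE identity
  `L_p(f,α,𝟙_{mℓ}) = (C a_ℓ − (1+T)^{−c} − (1+T)^{c}) · L_p(f,α,𝟙_m)` in `ℚ_p⟦T⟧` (`ℓ ≡ ω(ℓ)γ^{c}`);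
* `iwasawaToPowerSeries_tameEulerFactor_mul_mult` — the factor is in `Λ`, so integral lifts propagate;
* **`padicLFunctionTameMult_prod_primes`**, `iwasawaToPowerSeries_prod_tameEulerFactor_mul_mult` — for a finite set `S` of
  primes `ℓ ∤ N`, `ℓ ≠ p`, `m = ∏_{ℓ∈S} ℓ`: `L_p(f,α,𝟙_m) = (∏_{ℓ∈S} h_ℓ) · L_p(f,α,𝟙_1)` where `L_p(f,α,𝟙_1) =
  padicLFunctionTameMult f 1 α 1` is THE package function at `p ∣ N` (`PAdicLFunctionTameMultProofs` §4).

References: K. Matsuno, J. Number Theory 84 (2000), Lemma 2.2 (p. 85), Lemma 3.3 and proof of Thm. 3.1 (pp. 87–88)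
[Matsuno2000]; B. Mazur, J. Tate, J. Teitelbaum, Invent. Math. 84 (1986), §I.10–I.13 [MazurTateTeitelbaum1986Invent].
-/

noncomputable section

open scoped MatrixGroups ModularForm

open CongruenceSubgroup Filter Topology PowerSeries Literature.NumberTheory.EllipticCurves.ModularForms

namespace Literature.NumberTheory.EllipticCurves

section Main

variable {N : ℕ} [NeZero N] {f : CuspForm (Gamma0 N) 2} {p : ℕ} [Fact p.Prime] {m ℓ : ℕ} [NeZero m] [NeZero (m * ℓ)]

/-- **Level-`n` form of Matsuno's Lemma 3.3, one-term measure** (from Lemma 2.2 in unit-class form,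
`weighted_msdMeasureTameMult_levelChange`): the Riemann sum of `L_p(f, α, 𝟙_{mℓ})` is `a_ℓ ·` that of `L_p(f, α, 𝟙_m)`
minus the Riemann sums of the `𝟙_m`-weighted measure translated by `ℓ` and by `ℓ⁻¹` (classes `ω(ℓ) γ^{±c}`).
[cite: Matsuno2000, Lemma 2.2 (p. 85) and Lemma 3.3 (pp. 87–88)] -/
theorem padicLRiemannSumTameMult_mul_prime_eq (hf : IsNewform0 f)
    (hrat : ∀ r : ℚ, (ratPlusSymbol f r : ℝ) = normalizedPlusSymbol f r)
    (hℓ : ℓ.Prime) (hℓN : ¬ ℓ ∣ N) {aℓ : ℤ} (haℓ : cuspCoeff f ℓ = aℓ) (hmp : m.Coprime p) (hℓp : ℓ.Coprime p)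
    (hℓm : ℓ.Coprime m) (α : ℚ_[p])
    {teich : rootsOfUnity (torsionOrder p) ℤ_[p]} {c : ℤ_[p]}
    (hc : ∀ n : ℕ, PadicInt.toZModPow (n + cyclotomicExponent p) ((teich : ℤ_[p]ˣ) : ℤ_[p]) *
        (cyclotomicGenerator p : ZMod (p ^ (n + cyclotomicExponent p))) ^ (PadicInt.toZModPow n c).val =
          (ℓ : ZMod (p ^ (n + cyclotomicExponent p)))) (k n : ℕ) :
    padicLRiemannSumTameMult f (m * ℓ) α 1 k n =
      (aℓ : ℚ_[p]) * padicLRiemannSumTameMult f m α 1 k n -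
      (∑ᶠ z : rootsOfUnity (torsionOrder p) ℤ_[p], ∑ s : ZMod (p ^ n),
        (∑ b : ZMod m, (1 : DirichletCharacter ℚ_[p] m) b * msdMeasureTameMult f m α (n + cyclotomicExponent p)
            ((PadicInt.toZModPow (n + cyclotomicExponent p) ((teich : ℤ_[p]ˣ) : ℤ_[p]) *
              (cyclotomicGenerator p : ZMod (p ^ (n + cyclotomicExponent p))) ^ (PadicInt.toZModPow n c).val) *
            (PadicInt.toZModPow (n + cyclotomicExponent p) ((z : ℤ_[p]ˣ) : ℤ_[p]) *
              (cyclotomicGenerator p : ZMod (p ^ (n + cyclotomicExponent p))) ^ s.val)) b) *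
          ((s.val.choose k : ℕ) : ℚ_[p])) -
      (∑ᶠ z : rootsOfUnity (torsionOrder p) ℤ_[p], ∑ s : ZMod (p ^ n),
        (∑ b : ZMod m, (1 : DirichletCharacter ℚ_[p] m) b * msdMeasureTameMult f m α (n + cyclotomicExponent p)
            ((PadicInt.toZModPow (n + cyclotomicExponent p)
                (((teich⁻¹ : rootsOfUnity (torsionOrder p) ℤ_[p]) : ℤ_[p]ˣ) : ℤ_[p]) *
              (cyclotomicGenerator p : ZMod (p ^ (n + cyclotomicExponent p))) ^ (PadicInt.toZModPow n (-c)).val) *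
            (PadicInt.toZModPow (n + cyclotomicExponent p) ((z : ℤ_[p]ˣ) : ℤ_[p]) *
              (cyclotomicGenerator p : ZMod (p ^ (n + cyclotomicExponent p))) ^ s.val)) b) *
          ((s.val.choose k : ℕ) : ℚ_[p])) := by
  classical
  haveI := neZero_torsionOrder p
  haveI := Fintype.ofFinite (rootsOfUnity (torsionOrder p) ℤ_[p])
  rw [padicLRiemannSumTameMult_eq_sum_weighted f (m * ℓ) α 1 k n, padicLRiemannSumTameMult_eq_sum_weighted f m α 1 k n]
  simp only [finsum_eq_sum_of_fintype, Finset.mul_sum, ← Finset.sum_sub_distrib]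
  refine Finset.sum_congr rfl fun z _ ↦ Finset.sum_congr rfl fun s _ ↦ ?_
  rw [weighted_msdMeasureTameMult_levelChange f hf hrat hℓ hℓN haℓ hmp hℓp hℓm α]
  simp only [mul_comm _ ((ℓ : ZMod (p ^ (n + cyclotomicExponent p)))),
    mul_comm _ ((ℓ : ZMod (p ^ (n + cyclotomicExponent p)))⁻¹)]
  rw [← classMap_inv_eq_inv_natCast hℓp hc n, ← hc n]
  ring

/-- **Matsuno 2000, Lemma 3.3 for the one-term transform, coefficientwise** (`p ∣ N`, `ε(p) = 0`, trivial tame character,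
GOOD prime `ℓ ∤ N` prime to `p` and `m`, `α = a_p` with `‖α‖ = 1`, `ℓ ≡ ω(ℓ) γ^{c mod pⁿ}`):
`[T^k] L_p(f,α,𝟙_{mℓ}) = a_ℓ [T^k] L_p(f,α,𝟙_m) − ∑_{i≤k} (−c choose k−i)[T^i] L_p(f,α,𝟙_m) − ∑_{i≤k} (c choose k−i)[T^i] L_p(f,α,𝟙_m)`.
[cite: Matsuno2000, Lemma 3.3 (pp. 87–88)] [cite: MazurSwinnertonDyer1974Invent, §8 Lemma 2] -/
theorem padicLCoeffTameMult_mul_prime (hf : IsNewform0 f) (hQ : coeffField f = ⊥) (hpN : p ∣ N) (hmp : m.Coprime p)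
    {ap : ℤ} (hap : cuspCoeff f p = ap) {α : ℚ_[p]} (hα : (ap : ℚ_[p]) = α) (hαu : ‖α‖ = 1)
    (hℓ : ℓ.Prime) (hℓN : ¬ ℓ ∣ N) {aℓ : ℤ} (haℓ : cuspCoeff f ℓ = aℓ) (hℓp : ℓ.Coprime p) (hℓm : ℓ.Coprime m)
    {teich : rootsOfUnity (torsionOrder p) ℤ_[p]} {c : ℤ_[p]}
    (hc : ∀ n : ℕ, PadicInt.toZModPow (n + cyclotomicExponent p) ((teich : ℤ_[p]ˣ) : ℤ_[p]) *
        (cyclotomicGenerator p : ZMod (p ^ (n + cyclotomicExponent p))) ^ (PadicInt.toZModPow n c).val =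
          (ℓ : ZMod (p ^ (n + cyclotomicExponent p)))) (k : ℕ) :
    padicLCoeffTameMult f (m * ℓ) α 1 k =
      (aℓ : ℚ_[p]) * padicLCoeffTameMult f m α 1 k -
        ∑ i ∈ Finset.range (k + 1), algebraMap ℤ_[p] ℚ_[p] (Ring.choose (-c) (k - i)) * padicLCoeffTameMult f m α 1 i -
        ∑ i ∈ Finset.range (k + 1), algebraMap ℤ_[p] ℚ_[p] (Ring.choose c (k - i)) * padicLCoeffTameMult f m α 1 i := by
  have hα0 : α ≠ 0 := norm_ne_zero_iff.mp (by rw [hαu]; exact one_ne_zero)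
  have hrat : ∀ r : ℚ, (ratPlusSymbol f r : ℝ) = normalizedPlusSymbol f r := fun r ↦ ratCast_ratPlusSymbol_holds hf hQ r
  have hdist := sum_filter_weighted_msdMeasureTameMult_succ f hf hrat hpN hmp hap hα0 hα
    (1 : DirichletCharacter ℚ_[p] m)
  obtain ⟨C, hC⟩ := exists_norm_weighted_msdMeasureTameMult_le f
    (exists_nsmul_modularSymbol_mem_periodLattice_of_isNewform0 hf hQ) hαu (1 : DirichletCharacter ℚ_[p] m)
  have hRS : ∀ k n : ℕ, padicLRiemannSumTameMult f m α 1 k n = _ :=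
    fun k n ↦ padicLRiemannSumTameMult_eq_sum_weighted f m α 1 k n
  have hℓlim := tendsto_riemannSum_translate hdist hC hRS (fun k n ↦ rfl) k
    (RSz := fun k n ↦ ∑ᶠ z : rootsOfUnity (torsionOrder p) ℤ_[p], ∑ s : ZMod (p ^ n),
        (∑ b : ZMod m, (1 : DirichletCharacter ℚ_[p] m) b * msdMeasureTameMult f m α (n + cyclotomicExponent p)
            ((PadicInt.toZModPow (n + cyclotomicExponent p) ((teich : ℤ_[p]ˣ) : ℤ_[p]) *
              (cyclotomicGenerator p : ZMod (p ^ (n + cyclotomicExponent p))) ^ (PadicInt.toZModPow n c).val) *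
            (PadicInt.toZModPow (n + cyclotomicExponent p) ((z : ℤ_[p]ˣ) : ℤ_[p]) *
              (cyclotomicGenerator p : ZMod (p ^ (n + cyclotomicExponent p))) ^ s.val)) b) *
          ((s.val.choose k : ℕ) : ℚ_[p]))
  have hℓ'lim := tendsto_riemannSum_translate hdist hC hRS (fun k n ↦ rfl) k
    (RSz := fun k n ↦ ∑ᶠ z : rootsOfUnity (torsionOrder p) ℤ_[p], ∑ s : ZMod (p ^ n),
        (∑ b : ZMod m, (1 : DirichletCharacter ℚ_[p] m) b * msdMeasureTameMult f m α (n + cyclotomicExponent p)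
            ((PadicInt.toZModPow (n + cyclotomicExponent p)
                (((teich⁻¹ : rootsOfUnity (torsionOrder p) ℤ_[p]) : ℤ_[p]ˣ) : ℤ_[p]) *
              (cyclotomicGenerator p : ZMod (p ^ (n + cyclotomicExponent p))) ^ (PadicInt.toZModPow n (-c)).val) *
            (PadicInt.toZModPow (n + cyclotomicExponent p) ((z : ℤ_[p]ˣ) : ℤ_[p]) *
              (cyclotomicGenerator p : ZMod (p ^ (n + cyclotomicExponent p))) ^ s.val)) b) *
          ((s.val.choose k : ℕ) : ℚ_[p]))
  rw [neg_neg] at hℓ'lim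
  have hmain := tendsto_padicLRiemannSumTameMult hf hQ hpN hmp hap hα hαu (1 : DirichletCharacter ℚ_[p] m) k
  have hcomb : Tendsto (padicLRiemannSumTameMult f (m * ℓ) α 1 k) atTop
      (𝓝 ((aℓ : ℚ_[p]) * padicLCoeffTameMult f m α 1 k -
        ∑ i ∈ Finset.range (k + 1), algebraMap ℤ_[p] ℚ_[p] (Ring.choose (-c) (k - i)) *
          limUnder atTop (fun n ↦ padicLRiemannSumTameMult f m α 1 i n) -
        ∑ i ∈ Finset.range (k + 1), algebraMap ℤ_[p] ℚ_[p] (Ring.choose c (k - i)) *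
          limUnder atTop (fun n ↦ padicLRiemannSumTameMult f m α 1 i n))) := by
    refine (((hmain.const_mul _).sub hℓlim).sub hℓ'lim).congr fun n ↦ ?_
    exact (padicLRiemannSumTameMult_mul_prime_eq hf hrat hℓ hℓN haℓ hmp hℓp hℓm α hc k n).symm
  rw [padicLCoeffTameMult, hcomb.limUnder_eq]
  rfl

end Main

section Series

variable {N : ℕ} [NeZero N] {f : CuspForm (Gamma0 N) 2} {p : ℕ} [Fact p.Prime] {m ℓ : ℕ} [NeZero m] [NeZero (m * ℓ)]

/-- **Matsuno 2000, Lemma 3.3 for the one-term transform, as an identity of power series** (`p ∣ N`):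
`L_p(f,α,𝟙_{mℓ}) = (C a_ℓ − (1+T)^{−c} − (1+T)^{c}) · L_p(f,α,𝟙_m)` in `ℚ_p⟦T⟧`, with `(1+T)^{±c}` Mathlib's binomial series
over `ℤ_p` and `ℓ ≡ ω(ℓ) γ^{c}`. [cite: Matsuno2000, Lemma 3.3 (pp. 87–88)] -/
theorem padicLFunctionTameMult_mul_prime (hf : IsNewform0 f) (hQ : coeffField f = ⊥) (hpN : p ∣ N) (hmp : m.Coprime p)
    {ap : ℤ} (hap : cuspCoeff f p = ap) {α : ℚ_[p]} (hα : (ap : ℚ_[p]) = α) (hαu : ‖α‖ = 1)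
    (hℓ : ℓ.Prime) (hℓN : ¬ ℓ ∣ N) {aℓ : ℤ} (haℓ : cuspCoeff f ℓ = aℓ) (hℓp : ℓ.Coprime p) (hℓm : ℓ.Coprime m)
    {teich : rootsOfUnity (torsionOrder p) ℤ_[p]} {c : ℤ_[p]}
    (hc : ∀ n : ℕ, PadicInt.toZModPow (n + cyclotomicExponent p) ((teich : ℤ_[p]ˣ) : ℤ_[p]) *
        (cyclotomicGenerator p : ZMod (p ^ (n + cyclotomicExponent p))) ^ (PadicInt.toZModPow n c).val =
          (ℓ : ZMod (p ^ (n + cyclotomicExponent p)))) :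
    padicLFunctionTameMult f (m * ℓ) α 1 =
      (C (aℓ : ℚ_[p]) - PowerSeries.binomialSeries ℚ_[p] (-c) - PowerSeries.binomialSeries ℚ_[p] c) *
        padicLFunctionTameMult f m α 1 := by
  ext k
  have hB : ∀ c' : ℤ_[p], coeff k (PowerSeries.binomialSeries ℚ_[p] c' * padicLFunctionTameMult f m α 1) =
      ∑ i ∈ Finset.range (k + 1), algebraMap ℤ_[p] ℚ_[p] (Ring.choose c' (k - i)) * padicLCoeffTameMult f m α 1 i := by
    intro c'
    have h := coeff_C_mul_binomialSeries_mul 1 c' (padicLFunctionTameMult f m α 1) k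
    rw [map_one, one_mul, one_mul] at h
    rw [h]
    refine Finset.sum_congr rfl fun i _ ↦ ?_
    rw [coeff_padicLFunctionTameMult]
  rw [coeff_padicLFunctionTameMult, padicLCoeffTameMult_mul_prime hf hQ hpN hmp hap hα hαu hℓ hℓN haℓ hℓp hℓm hc k,
    sub_mul, sub_mul, map_sub, map_sub, coeff_C_mul, coeff_padicLFunctionTameMult, hB, hB]

omit [NeZero m] [NeZero (m * ℓ)] in
/-- `ι(C z) = C z` for an integer constant (`PowerSeries.map_C`); private helper. [folklore] -/
private theorem iwasawaToPowerSeries_C_intCast' (z : ℤ) :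
    iwasawaToPowerSeries p (C (z : ℤ_[p])) = C (z : ℚ_[p]) := by
  show PowerSeries.map _ (C _) = _
  rw [PowerSeries.map_C, map_intCast]

/-- **The factor `h_ℓ = a_ℓ − (1+T)^{−c} − (1+T)^{c}` is integral** (one-term transform): if `G ∈ Λ` lifts `L_p(f,α,𝟙_m)`,
then `(C a_ℓ − (1+T)^{−c} − (1+T)^{c}) · G ∈ Λ` lifts `L_p(f,α,𝟙_{mℓ})`. [cite: Matsuno2000, Lemma 3.3 (pp. 87–88)] -/
theorem iwasawaToPowerSeries_tameEulerFactor_mul_mult (hf : IsNewform0 f) (hQ : coeffField f = ⊥) (hpN : p ∣ N)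
    (hmp : m.Coprime p) {ap : ℤ} (hap : cuspCoeff f p = ap) {α : ℚ_[p]} (hα : (ap : ℚ_[p]) = α)
    (hαu : ‖α‖ = 1) (hℓ : ℓ.Prime) (hℓN : ¬ ℓ ∣ N) {aℓ : ℤ} (haℓ : cuspCoeff f ℓ = aℓ) (hℓp : ℓ.Coprime p)
    (hℓm : ℓ.Coprime m) {teich : rootsOfUnity (torsionOrder p) ℤ_[p]} {c : ℤ_[p]}
    (hc : ∀ n : ℕ, PadicInt.toZModPow (n + cyclotomicExponent p) ((teich : ℤ_[p]ˣ) : ℤ_[p]) *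
        (cyclotomicGenerator p : ZMod (p ^ (n + cyclotomicExponent p))) ^ (PadicInt.toZModPow n c).val =
          (ℓ : ZMod (p ^ (n + cyclotomicExponent p))))
    {G : IwasawaAlgebra p} (hG : iwasawaToPowerSeries p G = padicLFunctionTameMult f m α 1) :
    iwasawaToPowerSeries p
        ((C (aℓ : ℤ_[p]) - PowerSeries.binomialSeries ℤ_[p] (-c) - PowerSeries.binomialSeries ℤ_[p] c) * G) =
      padicLFunctionTameMult f (m * ℓ) α 1 := by
  rw [map_mul, map_sub, map_sub, hG, BurungaleSkinner2023.iwasawaToPowerSeries_binomialSeries,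
    BurungaleSkinner2023.iwasawaToPowerSeries_binomialSeries,
    iwasawaToPowerSeries_C_intCast', padicLFunctionTameMult_mul_prime hf hQ hpN hmp hap hα hαu hℓ hℓN haℓ hℓp hℓm hc]

end Series

/-! ### Iteration over the primes of a squarefree tame level -/

section Product

variable {N : ℕ} [NeZero N] {f : CuspForm (Gamma0 N) 2} {p : ℕ} [Fact p.Prime]

/-- **Depletion at a squarefree tame level, one-term transform** (Matsuno 2000, proof of Thm. 3.1 via Lemma 3.3, `p ∣ N`):
for a finite set `S` of primes `ℓ ∤ N`, `ℓ ≠ p`, with `a_ℓ(f) = a ℓ`, Teichmüller–exponent data `ℓ ≡ ω(ℓ) γ^{c ℓ}`, and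
`m = ∏_{ℓ∈S} ℓ`: `L_p(f,α,𝟙_m) = (∏_{ℓ∈S} (C a_ℓ − (1+T)^{−c_ℓ} − (1+T)^{c_ℓ})) · L_p(f,α,𝟙_1)` in `ℚ_p⟦T⟧`, where
`L_p(f,α,𝟙_1) = padicLFunctionTameMult f 1 α 1` (THE package function, `PAdicLFunctionTameMultProofs` §4).
[cite: Matsuno2000, Lemma 3.3 and proof of Theorem 3.1 (pp. 87–88)] -/
theorem padicLFunctionTameMult_prod_primes (hf : IsNewform0 f) (hQ : coeffField f = ⊥) (hpN : p ∣ N)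
    {ap : ℤ} (hap : cuspCoeff f p = ap) {α : ℚ_[p]} (hα : (ap : ℚ_[p]) = α) (hαu : ‖α‖ = 1)
    {a : ℕ → ℤ} {teich : ℕ → rootsOfUnity (torsionOrder p) ℤ_[p]} {c : ℕ → ℤ_[p]} :
    ∀ (S : Finset ℕ), (∀ ℓ ∈ S, ℓ.Prime ∧ ¬ ℓ ∣ N ∧ ℓ.Coprime p) → (∀ ℓ ∈ S, cuspCoeff f ℓ = a ℓ) →
      (∀ ℓ ∈ S, ∀ n : ℕ, PadicInt.toZModPow (n + cyclotomicExponent p) ((teich ℓ : ℤ_[p]ˣ) : ℤ_[p]) *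
        (cyclotomicGenerator p : ZMod (p ^ (n + cyclotomicExponent p))) ^ (PadicInt.toZModPow n (c ℓ)).val =
          (ℓ : ZMod (p ^ (n + cyclotomicExponent p)))) →
      ∀ (m : ℕ) [NeZero m], m = ∏ ℓ ∈ S, ℓ →
        padicLFunctionTameMult f m α 1 =
          (∏ ℓ ∈ S, (C ((a ℓ : ℤ) : ℚ_[p]) - PowerSeries.binomialSeries ℚ_[p] (-c ℓ) -
              PowerSeries.binomialSeries ℚ_[p] (c ℓ))) * padicLFunctionTameMult f 1 α 1 := by
  classical
  intro S
  induction S using Finset.induction_on with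
  | empty =>
    intro _ _ _ m _ hm
    rw [Finset.prod_empty] at hm
    subst hm
    rw [Finset.prod_empty, one_mul]
  | @insert ℓ₀ S hℓ₀ ih =>
    intro hS ha hc m _ hm
    have hm' : m = (∏ ℓ ∈ S, ℓ) * ℓ₀ := by
      rw [hm, ← Finset.prod_erase_mul _ _ (Finset.mem_insert_self ℓ₀ S), Finset.erase_insert hℓ₀]
    subst hm'
    have hS' : ∀ ℓ ∈ S, ℓ.Prime ∧ ¬ ℓ ∣ N ∧ ℓ.Coprime p := fun ℓ h ↦ hS ℓ (Finset.mem_insert_of_mem h)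
    obtain ⟨hℓ₀p, hℓ₀N, hℓ₀cp⟩ := hS ℓ₀ (Finset.mem_insert_self ℓ₀ S)
    haveI : NeZero (∏ ℓ ∈ S, ℓ) :=
      ⟨Finset.prod_ne_zero_iff.mpr fun ℓ h ↦ (hS' ℓ h).1.ne_zero⟩
    have hmp : (∏ ℓ ∈ S, ℓ).Coprime p := Nat.Coprime.prod_left fun ℓ h ↦ (hS' ℓ h).2.2
    have hℓm : ℓ₀.Coprime (∏ ℓ ∈ S, ℓ) := by
      refine Nat.Coprime.prod_right fun ℓ h ↦ (Nat.coprime_primes hℓ₀p (hS' ℓ h).1).mpr ?_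
      rintro rfl
      exact hℓ₀ h
    rw [Finset.prod_insert hℓ₀, mul_assoc,
      ← ih hS' (fun ℓ h ↦ ha ℓ (Finset.mem_insert_of_mem h)) (fun ℓ h ↦ hc ℓ (Finset.mem_insert_of_mem h)) _ rfl]
    exact padicLFunctionTameMult_mul_prime hf hQ hpN hmp hap hα hαu hℓ₀p hℓ₀N (ha ℓ₀ (Finset.mem_insert_self ℓ₀ S))
      hℓ₀cp hℓm (hc ℓ₀ (Finset.mem_insert_self ℓ₀ S))

/-- **`Λ`-form of the depletion at a squarefree tame level, one-term transform**: with `S`, `m = ∏_{ℓ∈S} ℓ` as in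
`padicLFunctionTameMult_prod_primes` and `G ∈ Λ` an integral lift of `L_p(f,α,𝟙_1) = padicLFunctionTameMult f 1 α 1`,
the element `(∏_{ℓ∈S} (C a_ℓ − (1+T)^{−c_ℓ} − (1+T)^{c_ℓ})) · G ∈ Λ` lifts `L_p(f,α,𝟙_m)`.
[cite: Matsuno2000, Lemma 3.3 and proof of Theorem 3.1 (pp. 87–88)] -/
theorem iwasawaToPowerSeries_prod_tameEulerFactor_mul_mult (hf : IsNewform0 f) (hQ : coeffField f = ⊥) (hpN : p ∣ N)
    {ap : ℤ} (hap : cuspCoeff f p = ap) {α : ℚ_[p]} (hα : (ap : ℚ_[p]) = α) (hαu : ‖α‖ = 1)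
    {a : ℕ → ℤ} {teich : ℕ → rootsOfUnity (torsionOrder p) ℤ_[p]} {c : ℕ → ℤ_[p]} {S : Finset ℕ}
    (hS : ∀ ℓ ∈ S, ℓ.Prime ∧ ¬ ℓ ∣ N ∧ ℓ.Coprime p) (ha : ∀ ℓ ∈ S, cuspCoeff f ℓ = a ℓ)
    (hc : ∀ ℓ ∈ S, ∀ n : ℕ, PadicInt.toZModPow (n + cyclotomicExponent p) ((teich ℓ : ℤ_[p]ˣ) : ℤ_[p]) *
        (cyclotomicGenerator p : ZMod (p ^ (n + cyclotomicExponent p))) ^ (PadicInt.toZModPow n (c ℓ)).val =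
          (ℓ : ZMod (p ^ (n + cyclotomicExponent p))))
    {m : ℕ} [NeZero m] (hm : m = ∏ ℓ ∈ S, ℓ) {G : IwasawaAlgebra p}
    (hG : iwasawaToPowerSeries p G = padicLFunctionTameMult f 1 α 1) :
    iwasawaToPowerSeries p
        ((∏ ℓ ∈ S, (C ((a ℓ : ℤ) : ℤ_[p]) - PowerSeries.binomialSeries ℤ_[p] (-c ℓ) -
            PowerSeries.binomialSeries ℤ_[p] (c ℓ))) * G) = padicLFunctionTameMult f m α 1 := by
  rw [map_mul, map_prod, hG, padicLFunctionTameMult_prod_primes hf hQ hpN hap hα hαu S hS ha hc m hm]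
  congr 1
  refine Finset.prod_congr rfl fun ℓ _ ↦ ?_
  rw [map_sub, map_sub, BurungaleSkinner2023.iwasawaToPowerSeries_binomialSeries,
    BurungaleSkinner2023.iwasawaToPowerSeries_binomialSeries,
    iwasawaToPowerSeries_C_intCast']

end Product

end Literature.NumberTheory.EllipticCurves

end
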